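import Mathlib
import HarnessLib
import Literature.Analysis.FluidPDE.ClassicalSolution
import Literature.Analysis.FluidPDE.VectorCalculus
import Literature.Analysis.FluidPDE.NSBoundedMildOseen
import Literature.Analysis.UnboundedOperators.HeatKernel
import Summits.NavierStokesRegularity.NavierStokesRegularity.Theorems.UnthreadedRigidityDoorUnthreadedRigidityMixedPairDefs

/-!
# Route `UnthreadedRigidityDoor`, item `UnthreadedRigidity` (W2, stmt-NavierStokesRegularity-27585) — LINE g11-2 «MIXED PAIR», ADDENDA 2A/2A′/2A″
# (v1.1–v1.4): THE MAGIC-ANGLE SECTOR — typed objects, statements and exact certificates (Theorems-side twin of the sketch, part 2)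

Definition file, part 2 of the twin of `MixedPair_sketch.lean` v1.4 (sha16 fdd225c37c2e9dbd; part 1 = `…MixedPairDefs.lean`): the residual class
R-MAGIC of LINE g11-2 and the instruments that attack it (part 2 = the CORED sector) — `IsMagic`, `IsAnalyticEven`, `HasCore`, `HasGenericCore`,
the exact GERM CERTIFICATE `germCertificate_B_mul_a_eq_zero` (five Taylor equations ⇒ `B·a₁³ = 0`) and `coreLaw_bookkeeping`, the bridges/supports
`MagicGermRigidity` (G-C), `HelmholtzLinkedNull` (S-H′), the rungs `MagicPairOrderTwoRigidity`, `MagicWindowReduction` (G-W),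
`MagicPairWindowRigidity`.  Part 3 (`…MixedPairCorelessDefs.lean`) = the R-CORELESS / Pell sector and the AE rungs; `UniaxialQuadShellAxisym` (S-QU)
is in part 1.  Every def/Prop BODY and every proof is VERBATIM from the sketch; namespace
`…Theorems.UnthreadedRigidity.MixedPair`; shared g10/g11-1 objects opened from the PROFILE/VIRIAL HORN twins as in part 1.  Filed by engine-1 g71
(DIRECTOR-NS dss_147 (3)); author of the statements: planner ns-idea-6 g11/g12 (idea-crit-7 PASS v1.1–v1.4).

WHAT THIS IS NOT: no NS-regularity statement is touched; `UnthreadedRigidity` (27585), W2 and NS regularity stay OPEN; nobody here claims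
`UnthreadedRigidity`.  `--supports stmt-NavierStokesRegularity-27585 --as helper`.  [cite: MajdaBertozziCUP2002, §1.1 (vector identities)]
-/

-- the summit and its single sub-problem share the name (CONVENTIONS §1)
set_option linter.dupNamespace false

namespace Summit.NavierStokesRegularity.NavierStokesRegularity.Theorems.UnthreadedRigidity.MixedPair

open scoped Topology
open Filter Set
open Summit.NavierStokesRegularity.NavierStokesRegularity.Theorems.UnthreadedRigidity.ProfileHorn (E3 threadingFlux IsSliceAxisymmetric)
open Summit.NavierStokesRegularity.NavierStokesRegularity.Theorems.UnthreadedRigidity.VirialHorn (e det3 vortAmpL VirialAdmissible sepShellL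
  WindowAxisUniform)

/-! ## ADDENDUM g11-2A (v1.1, 2026-08-29): the residual R-MAGIC attacked — the MAGIC GERM; and the Helmholtz null lemma

THE MAGIC CLASS.  `Q_aa = 0`, `Qa ≠ 0`, `Q` uniaxial ⇔ `Q = λ(b⊗b − ⅓)` with `(a·b)² = |a|²|b|²/3` (magic angle).  Every such configuration is a
rotation + scaling of the RATIONAL MODEL `a = e₃`, `Y_Q = xy + yz + zx` (axis `b = (1,1,1)/√3`), on which the engine runs exactly (kit j325083,
j325054): `{Y₁,Y₂} = −(x−y)(x+y+z)`; the `B³` jet vanishes (`D_Q ≡ 0` for uniaxial `Q`), and `c₂` has exactly FOUR independent radial functionals,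
one per channel `V₁…V₄`, each carried by ONE harmonic (the pair is invariant under the reflection `x ↔ y`, `c₂` is odd under it):
`Φ₁ ∝ A²B` (the CHANNEL-ONE LAW below), `Φ₂ ∋ V′`-law·`AB` + `AB²`, `Φ₃ ∝ A²B`, `Φ₄ ∝ AB²`.  No virial weight isolates a signed functional
(g11-2 CARD §4: the bad set of the shape lemma is exactly this class), so the line changes instrument:

THE GERM AT THE CENTRE.  For a linked pair with profiles analytic-even at `r = 0` and a CORED dipole (`H₁(0) = A ≠ 0`; NS scaling + parity
normalise `A = 1`), everything is a formal power series in `r²` driven by the Taylor coefficients `a_k` of `H₁ = 1 + Σ a_k r^{2k}`: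
`V = K₁/H₁`, `H₂ = B·h` with `h` the regular solution of `h″ + 6h′/r = 3Vh`, `h(0) = 1` (`h_k = 3[Vh]_{k−1}/(2k(2k+5))`), the pressure
multipole functions `b_L = β_L + Σ_k b_{L,k} r^{2k}` (regular solutions of `b″ + 2(L+1)b′/r = −σ_L`, ONE free constant `β_L` each, fixed globally by
decay but free for the germ).  Order-two silence near `x₀` makes every Taylor coefficient of `Ψ₁ := Φ₁/V` and `Ψ₃ := Φ₃/V` vanish.  With
`a₁ ≠ 0` (GENERIC CORE, `H₁″(0) ≠ 0`) the first five of these equations read (engine, exact; kit j325347):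
  `[Ψ₁]₀ : (5/6)a₁(12B − β₁) = 0`                                   ⇒ `β₁ = 12B`
  `[Ψ₁]₂ : 189Ba₁² + 84Ba₂ − 7a₂β₁ + 6Ba₁β₂ = 0`                     ⇒ `β₂ = −63a₁/2`
  `[Ψ₃]₁ : (15/28)a₁(24Ba₁ + 7β₃ − 28Bβ₂) = 0`                       ⇒ `β₃ = −906Ba₁/7`
  `[Ψ₁]₄ : 5535Ba₁³ + 18998Ba₁a₂ + (3780B − 315β₁)a₃ + 160Ba₁²β₂ + 392Ba₂β₂ = 0`  (`a₃` drops)  ⇒ `a₂ = −99a₁²/1330`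
  `[Ψ₃]₃ : 3220Ba₁³ − 4312Ba₁a₂ − 441a₂β₃ + 720Ba₁²β₂ + 1764Ba₂β₂ = 0`  ⇒ after substitution `−(2560460/133)·B·a₁³ = 0`,
so `B = 0`: THE GENERIC-CORE MAGIC PAIR IS KILLED AT ORDER TWO by the dipole-weight channels `V₁`, `V₃` of the second jet (the `AB²` channels
`V₂`, `V₄` are not even needed).  FLAT CORES (`a₁ = … = a_{m−1} = 0 ≠ a_m`, `m ≥ 2`) die by channel 3 ALONE — MAGIC CORE LAW (hand, first order in
`a_m` around the trivial core `H₁ ≡ 1`, `h ≡ 1`, `V ≡ 0`): `[Ψ₃]₁ = (3/8)(β₃ − 4Bβ₂)`, and then `[Ψ₃]_{2m−1} = 6m(2m+1)/(2m+5)·a_m·B` (contributions: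
`H₁²H₂′ → 6m(2m+3)/(2m+5)`, `−(3/2)H₁H₁′H₂ → −3m`, bilinear pressure `b₃` with source `−48m(m−1)a_mB r^{2m−4}` → `+3m(2m+1)/(2m+5)`; everything else is
`O(a_m²)` or of order `≥ 2m+1`), hence `B = 0`; machine-confirmed at `m = 2, 3`: `[Φ₃]_{4m−3} = V_{2m−2}[Ψ₃]_{2m−1} = 12m²(2m+1)(2m+3)/(2m+5)·B a_m²`
`= (560/3)Ba₂², (6804/11)Ba₃²` (kit j325400, j325484; `m = 4`: j325486).  So EVERY CORED magic pair (`H₁(0) ≠ 0`) dies at order two.  CORELESS dipoles (`H₁(0) = 0`, `H₁ = a r^{2m}(1+…)`): linkage alone forces `H₂ ≡ 0` unless the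
indicial equation `2j(2j+5) = 6m(2m+3)` has a solution, i.e. `(4j+5)² − 3(4m+3)² = −2` — a Pell branch, the smallest being `(m, j) = (142, 246)`;
these are the residual R-CORELESS (a leading-order computation there is owed).  CONSISTENCY CHECKS: the channel-1 eliminations on the magic model
coincide with those of the oblique model B (`β₁ = 12B`, `β₂ = −63a₁/2`, `a₂ = −99a₁²/1330`; j325144 vs j325158) as the `Q`-universality of the
CHANNEL-ONE LAW predicts; `magic_germ.py` validated on a hand-built input; all functionals come from the g11-2 engine whose identities
(`div`, Beltrami-sphere, `Δp + σ = 0`, order-one law, quad law) are exact.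

CHANNEL-ONE LAW (hand, from the engine's `Φ_{1,0}`; valid for every traceless `Q` with `Qa ≠ 0` by `Q`-linearity of the `A²B` terms):
`c₂|_{V₁} = 12·V·Ψ·(Qa·y)⊥-carrier`, `Ψ = (1/10) r^{−5}(r²H₁)′(r⁵H₁H₂)′ − (1/12) H₁ e₁[b₁] + (r²/10) H₂ e₂[b₂₀]`, `e_L[b] := Lb + rb′`,
`b₁` = the bilinear dipole-weight pressure function (source `−(6/5)(−3H₁H₂V + rH₁H₂′V + 3rH₁′H₂V − 8H₁′H₂′)`), `b₂₀` = the dipole's own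
quadrupole pressure (source `2H₁′(rH₁V + 2H₁′)/r²`).

THE HELMHOLTZ NULL LEMMA (answers the critic's request (6) for an exact certificate behind S-H): no certificate is needed — a GLOBALLY
Helmholtz-linked admissible pair is null by DECAY alone.  `K₁ = cH₁` on `(0,∞)` with `H₁` smooth-even: `c = −k² < 0` ⇒ `H₁ = A j₁(kr)/r`, and
`r³H₁ = A(sin kr/k² − r cos kr/k)` is unbounded unless `A = 0`; `c = 0` ⇒ `H₁ = α + βr^{−3}` ⇒ `β = 0` (smooth), `α = 0` (decay); `c > 0` ⇒ the
regular solution `i₁(√c r)/r` grows exponentially.  Likewise `K₂ = 3cH₂` (`j₂(√3kr)/r²`, `r⁴H₂` unbounded; `α + βr^{−5}`; `i₂`).  So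
`HelmholtzLinkedNull` below (support, S; Lean M−: a 2nd-order linear ODE on `(0,∞)` has a 2-dimensional solution space + the closed forms) implies
S-H and S-HW by logic (`helmholtzPairDead_of_null`, `helmholtzWindowDead_of_null`, kernel-checked).

WHAT THE ADDENDUM BUYS.  With g11-2: in the `l ≤ 2` poloidal steady-slice sector every non-coaxial linked pair is killed at jet order ≤ 2 EXCEPT
magic pairs whose dipole vanishes at the centre (R-CORELESS: Pell branches, `m ≥ 142`), and modulo the profile class (analytic-even germs —
automatic at window level by NS smoothing, bridge G-W).  No summit, and not 27585, is proved; the rungs below are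
restrictions of 27585 to explicit data classes, closed modulo the named bridges. -/

/-- MAGIC(-ANGLE) quadrupole relative to the dipole axis `a`: `Q_aa = 0`, `Qa ≠ 0`, `Q` uniaxial (the residual class R-MAGIC of the rungs above). -/
def IsMagic (a : E3) (Q : E3 →L[ℝ] E3) : Prop := inner ℝ (Q a) a = 0 ∧ Q a ≠ 0 ∧ IsUniaxial Q

/-- ANALYTIC-EVEN profile: `H(r) = h(r²)` on `[0,∞)` with `h` real-analytic on a neighbourhood of `[0,∞)` (an analytic even germ at the centre and
analyticity on `(0,∞)`; at window level this is NS space-analyticity of interior slices + rotation-invariance of the angular projections). -/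
def IsAnalyticEven (H : ℝ → ℝ) : Prop :=
  ∃ h : ℝ → ℝ, AnalyticOnNhd ℝ h (Set.Ici 0) ∧ ∀ r : ℝ, 0 ≤ r → H r = h (r ^ 2)

/-- CORED profile: analytic-even with `H(0) ≠ 0` (then `V = K₁/H₁` is analytic at the centre; with the decay clause of `VirialAdmissible` a cored
profile is automatically non-constant, so its even Taylor series `h(0) + Σ a_k r^{2k}` has a first non-zero `a_m`, `m ≥ 1` — the branch index of the
germ analysis: `m = 1` GENERIC core, `m ≥ 2` FLAT core of order `m`). -/
def HasCore (H : ℝ → ℝ) : Prop :=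
  ∃ h : ℝ → ℝ, AnalyticOnNhd ℝ h (Set.Ici 0) ∧ (∀ r : ℝ, 0 ≤ r → H r = h (r ^ 2)) ∧ h 0 ≠ 0

/-- GENERIC CORE (the machine-certified branch `a₁ ≠ 0`, kept for reference): cored with `h′(0) ≠ 0`, i.e. `H″(0) ≠ 0`. -/
def HasGenericCore (H : ℝ → ℝ) : Prop :=
  ∃ h : ℝ → ℝ, AnalyticOnNhd ℝ h (Set.Ici 0) ∧ (∀ r : ℝ, 0 ≤ r → H r = h (r ^ 2)) ∧ h 0 ≠ 0 ∧ deriv h 0 ≠ 0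

/-- bookkeeping: a generic core is a core. -/
lemma hasCore_of_generic {H : ℝ → ℝ} (h : HasGenericCore H) : HasCore H := by
  obtain ⟨g, hg, hH, h0, _⟩ := h
  exact ⟨g, hg, hH, h0⟩

/-- KERNEL CERTIFICATE for THEOREM G's L-part (generic core; critic suggestion idea-crit-7 g6 05:22Z): the five engine rows of kit j325347
(`[Ψ₁]₀, [Ψ₁]₂, [Ψ₃]₁, [Ψ₁]₄, [Ψ₃]₃` on the magic model, gauge `A = 1`) as polynomial equations over `ℝ` force `B·a₁ = 0`.  With this, only the
five rows themselves (engine output) remain the M-part of bridge G on the generic branch. -/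
theorem germCertificate_B_mul_a_eq_zero (B a₁ a₂ a₃ β₁ β₂ β₃ : ℝ)
    (r1 : 5 / 6 * a₁ * (12 * B - β₁) = 0)
    (r2 : 189 * B * a₁ ^ 2 + 84 * B * a₂ - 7 * a₂ * β₁ + 6 * B * a₁ * β₂ = 0)
    (r3 : 15 / 28 * a₁ * (24 * B * a₁ + 7 * β₃ - 28 * B * β₂) = 0)
    (r4 : 5535 * B * a₁ ^ 3 + 18998 * B * a₁ * a₂ + (3780 * B - 315 * β₁) * a₃
            + 160 * B * a₁ ^ 2 * β₂ + 392 * B * a₂ * β₂ = 0)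
    (r5 : 3220 * B * a₁ ^ 3 - 4312 * B * a₁ * a₂ - 441 * a₂ * β₃ + 720 * B * a₁ ^ 2 * β₂
            + 1764 * B * a₂ * β₂ = 0) :
    B * a₁ = 0 := by
  by_contra h
  have hB : B ≠ 0 := fun hB => h (by rw [hB, zero_mul])
  have ha : a₁ ≠ 0 := fun ha => h (by rw [ha, mul_zero])
  -- row 1: β₁ = 12B
  have e1 : β₁ = 12 * B := by
    have h1 : a₁ * (12 * B - β₁) = 0 := by linear_combination (6 / 5 : ℝ) * r1
    rcases mul_eq_zero.mp h1 with h0 | h0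
    · exact absurd h0 ha
    · linarith
  subst e1
  -- row 2: β₂ = -63 a₁ / 2
  have e2 : β₂ = -(63 / 2) * a₁ := by
    have h2 : (B * a₁) * (63 * a₁ + 2 * β₂) = 0 := by linear_combination (1 / 3 : ℝ) * r2
    rcases mul_eq_zero.mp h2 with h0 | h0
    · exact absurd h0 h
    · linarith
  subst e2
  -- row 3: β₃ = -906 B a₁ / 7
  have e3 : β₃ = -(906 / 7) * B * a₁ := by
    have h3 : a₁ * (906 * B * a₁ + 7 * β₃) = 0 := by linear_combination (28 / 15 : ℝ) * r3
    rcases mul_eq_zero.mp h3 with h0 | h0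
    · exact absurd h0 ha
    · linarith
  subst e3
  -- row 4: a₂ = -99 a₁² / 1330
  have e4 : a₂ = -(99 / 1330) * a₁ ^ 2 := by
    have h4 : (B * a₁) * (99 * a₁ ^ 2 + 1330 * a₂) = 0 := by linear_combination (1 / 5 : ℝ) * r4
    rcases mul_eq_zero.mp h4 with h0 | h0
    · exact absurd h0 h
    · linarith
  subst e4
  -- row 5: -(2560460/133) B a₁³ = 0, contradiction
  have h5 : (B * a₁) * (a₁ * a₁) = 0 := by linear_combination (-(133 / 2560460) : ℝ) * r5
  rcases mul_eq_zero.mp h5 with h0 | h0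
  · exact h h0
  · rcases mul_eq_zero.mp h0 with h6 | h6 <;> exact ha h6

/-- MAGIC CORE LAW bookkeeping (flat core of order `m ≥ 2`, ADDENDUM §3): the three first-order contributions to `[Ψ₃]_{2m−1}/(a_m B)` —
`H₁²H₂′ ↦ 6m(2m+3)/(2m+5)`, `−(3/2)H₁H₁′H₂ ↦ −3m`, channel-3 pressure `↦ 3m(2m+1)/(2m+5)` — sum to `6m(2m+1)/(2m+5)`, which is non-zero; and the
solver's coefficients of `B a_m²` at order `r^{4m−3}`, `V_{2m−2}[Ψ₃]_{2m−1}/(B a_m²) = 12m²(2m+1)(2m+3)/(2m+5)`, are `560/3, 6804/11, 19008/13` at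
`m = 2, 3, 4` — printed with denominators cleared as `560, 6804, 19008` (kit j325400/j325484/j325486). -/
theorem coreLaw_bookkeeping (m : ℕ) :
    (6 * m * (2 * m + 3) - 3 * m * (2 * m + 5) + 3 * m * (2 * m + 1) : ℚ) = 6 * m * (2 * m + 1) ∧
    (2 ≤ m → (6 * m * (2 * m + 1) : ℚ) / (2 * m + 5) ≠ 0) ∧
    ((12 * 2 ^ 2 * (2 * 2 + 1) * (2 * 2 + 3) : ℚ) / (2 * 2 + 5) = 560 / 3 ∧
      (12 * 3 ^ 2 * (2 * 3 + 1) * (2 * 3 + 3) : ℚ) / (2 * 3 + 5) = 6804 / 11 ∧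
      (12 * 4 ^ 2 * (2 * 4 + 1) * (2 * 4 + 3) : ℚ) / (2 * 4 + 5) = 19008 / 13) := by
  refine ⟨by ring, ?_, by norm_num⟩
  intro hm
  have hm' : (0 : ℚ) < m := by exact_mod_cast (by omega : 0 < m)
  have h1 : (0 : ℚ) < 6 * m * (2 * m + 1) :=
    mul_pos (mul_pos (by norm_num) hm') (by positivity)
  have h2 : (0 : ℚ) < 2 * m + 5 := by positivity
  exact (div_pos h1 h2).ne'

/-- BRIDGE G «MAGIC GERM RIGIDITY» (M–L), for every CORED magic pair.  L = (generic core, `m = 1`) the five-coefficient certificate above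
(engine-exact: `[Ψ₁]₀,₂,₄`, `[Ψ₃]₁,₃` on the rational magic model, to which every magic configuration is conjugate by a rotation and a scaling of
`Q`) + (flat core of order `m ≥ 2`) the MAGIC CORE LAW: `[Ψ₃]₁ = (3/8)(β₃ − 4Bβ₂)` and then `[Ψ₃]_{2m−1} = 6m(2m+1)/(2m+5)·a_m·B` (hand, first order
in `a_m` around the trivial core — `H₂′`, `H₁′H₂` and the bilinear channel-3 pressure are the only contributions at that order; machine-confirmed at
`m = 2, 3` as `[Φ₃]_{4m−3} = 2m(2m+3)a_m·[Ψ₃]_{2m−1} ∝ 560·Ba₂², 6804·Ba₃²`, kit j325400/j325484); NS scaling + parity normalise `H₁(0) = 1`; `B = 0`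
⇒ `H₂ ≡ 0` near `0` by uniqueness of the regular solution of the linkage ODE ⇒ `H₂ ≡ 0` on `[0,∞)` by analyticity.  M = order-two silence near `x₀`
(from the one-sided second jet of a classical solution with these data) annihilates the `V₁` and `V₃` components of `c₂`, i.e. (as `V ≢ 0`) every
Taylor coefficient of `Ψ₁ = Φ₁/V`, `Ψ₃ = Φ₃/V`.  WHY IT MIGHT FAIL: the `m = 1` certificate is machine algebra (sympy, exact rationals) on functionals
produced by the g11-2 engine (both channel rows cross-validated on the oblique model B, kit j325161); the `m ≥ 2` law is a one-page hand expansion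
checked at two values of `m`; CORELESS dipoles (`H₁(0) = 0`) are EXCLUDED by hypothesis (residual R-CORELESS: Pell branches). -/
def MagicGermRigidity : Prop :=
  ∀ (t₀ T : ℝ) (u : ℝ → E3 → E3) (p : ℝ → E3 → ℝ) (x₀ a : E3) (Q : E3 →L[ℝ] E3) (H₁ H₂ : ℝ → ℝ),
    t₀ < T →
    Literature.Analysis.FluidPDE.IsClassicalNSSolutionOn (Set.Ico t₀ T) 1 0 u p →
    (∀ t ∈ Set.Ico t₀ T, Tendsto (p t) (cocompact E3) (𝓝 0)) →
    (∀ x : E3, ContDiffWithinAt ℝ 2 (fun t => threadingFlux u x₀ t x) (Set.Ici t₀) t₀) →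
    PairAdmissible H₁ H₂ a Q → IsMagic a Q → u t₀ = pairShell H₁ H₂ a Q x₀ →
    HasCore H₁ → IsAnalyticEven H₂ → IsLinked H₁ H₂ →
    (∀ x : E3, iteratedDerivWithin 2 (fun t => threadingFlux u x₀ t x) (Set.Ici t₀) t₀ = 0) →
    IsNullProfile H₂

/-- S-H′ «HELMHOLTZ-LINKED ADMISSIBLE PROFILES ARE NULL» (support, S; Lean M−): decay versus the closed forms `j₁(kr)/r`, `j₂(√3kr)/r²`
(`c < 0`), `α + βr^{−2l−1}` (`c = 0`), modified Bessel growth (`c > 0`).  Implies S-H and S-HW by logic (below). -/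
def HelmholtzLinkedNull : Prop :=
  ∀ (H₁ H₂ : ℝ → ℝ), VirialAdmissible 1 H₁ → VirialAdmissible 2 H₂ → IsHelmholtzLinked H₁ H₂ → IsNullProfile H₁ ∧ IsNullProfile H₂

/-- MAGIC SLICE RUNG: the slice rung extended to MAGIC pairs with a CORED analytic dipole (`H₁(0) ≠ 0`) (`¬ IsCoaxial` is implied by `IsMagic` for
symmetric `Q` — kept explicit as bookkeeping). -/
def MagicPairOrderTwoRigidity : Prop :=
  ∀ (t₀ T : ℝ) (u : ℝ → E3 → E3) (p : ℝ → E3 → ℝ) (x₀ a : E3) (Q : E3 →L[ℝ] E3) (H₁ H₂ : ℝ → ℝ),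
    t₀ < T →
    Literature.Analysis.FluidPDE.IsClassicalNSSolutionOn (Set.Ico t₀ T) 1 0 u p →
    (∀ t ∈ Set.Ico t₀ T, Tendsto (p t) (cocompact E3) (𝓝 0)) →
    (∀ x : E3, ContDiffWithinAt ℝ 2 (fun t => threadingFlux u x₀ t x) (Set.Ici t₀) t₀) →
    PairAdmissible H₁ H₂ a Q → IsMagic a Q → ¬ IsCoaxial a Q → u t₀ = pairShell H₁ H₂ a Q x₀ →
    HasCore H₁ → IsAnalyticEven H₂ →
    (∀ x : E3, iteratedDerivWithin 1 (fun t => threadingFlux u x₀ t x) (Set.Ici t₀) t₀ = 0) →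
    (∀ x : E3, iteratedDerivWithin 2 (fun t => threadingFlux u x₀ t x) (Set.Ici t₀) t₀ = 0) →
    IsSliceAxisymmetric (u t₀) x₀

/-- BRIDGE G-W «MAGIC WINDOW REDUCTION» (M–L): in a window of 27585 all of whose slices are admissible MAGIC pairs over fixed `a`, `Q`
(time-dependent profiles) with a cored dipole (`H₁(t,0) ≠ 0`) at every slice, interior slices are space-analytic (so the profiles are analytic-even: the
angular projections of an analytic field are analytic functions of `|y|²`), all jets of the vanishing flux vanish at interior times, order one
links the profiles (S-L) and BRIDGE G kills the quadrupole slicewise; slices at non-interior times by continuity in `t`.  WHY IT MIGHT FAIL: as O-W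
of g11-2, plus the per-slice core hypothesis (a slice whose dipole vanishes at the centre is not covered — R-CORELESS). -/
def MagicWindowReduction : Prop :=
  ∀ (S : Set ℝ), IsOpen S → ∀ (u : ℝ → E3 → E3) (x₀ : E3),
    ContinuousOn (Function.uncurry u) (S ×ˢ Set.univ) →
    (∀ t ∈ S, Literature.Analysis.FluidPDE.VectorCalculus.IsDivFree (u t)) →
    (∀ s ∈ S, ∀ t ∈ S, s < t → ∀ x, u t x =
        Literature.Analysis.UnboundedOperators.heatExtension (u s) (t - s) x
          - Literature.Analysis.FluidPDE.oseenDuhamel 1 s u u t x) →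
    (∀ τ ∈ S, ∃ B : ℝ, ∀ t ∈ S, t ≤ τ → ∀ x, ‖u t x‖ ≤ B) →
    (∀ t ∈ S, ∀ x, inner ℝ (Literature.Analysis.FluidPDE.curl (u t) x) (x - x₀) = 0) →
    ∀ (a : E3) (Q : E3 →L[ℝ] E3) (H₁f H₂f : ℝ → ℝ → ℝ), IsMagic a Q →
    (∀ t ∈ S, PairAdmissible (H₁f t) (H₂f t) a Q ∧ HasCore (H₁f t) ∧ u t = pairShell (H₁f t) (H₂f t) a Q x₀) →
    ∀ t ∈ S, IsNullProfile (H₂f t)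

/-- MAGIC WINDOW RUNG = the crux 27585 with its hypotheses VERBATIM, restricted to windows all of whose slices are admissible magic pairs about
`x₀` over a fixed axis and shape, with a cored analytic dipole at every slice. -/
def MagicPairWindowRigidity : Prop :=
  ∀ (S : Set ℝ), IsOpen S → IsPreconnected S → ∀ (u : ℝ → E3 → E3) (x₀ : E3),
    ContinuousOn (Function.uncurry u) (S ×ˢ Set.univ) →
    (∀ t ∈ S, Literature.Analysis.FluidPDE.VectorCalculus.IsDivFree (u t)) →
    (∀ s ∈ S, ∀ t ∈ S, s < t → ∀ x, u t x =
        Literature.Analysis.UnboundedOperators.heatExtension (u s) (t - s) x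
          - Literature.Analysis.FluidPDE.oseenDuhamel 1 s u u t x) →
    (∀ τ ∈ S, ∃ B : ℝ, ∀ t ∈ S, t ≤ τ → ∀ x, ‖u t x‖ ≤ B) →
    (∀ t ∈ S, ∀ x, inner ℝ (Literature.Analysis.FluidPDE.curl (u t) x) (x - x₀) = 0) →
    (∃ (a : E3) (Q : E3 →L[ℝ] E3) (H₁f H₂f : ℝ → ℝ → ℝ), IsMagic a Q ∧
        ∀ t ∈ S, PairAdmissible (H₁f t) (H₂f t) a Q ∧ HasCore (H₁f t) ∧ u t = pairShell (H₁f t) (H₂f t) a Q x₀) →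
    ∃ A : E3 →L[ℝ] E3, (∀ x, inner ℝ (A x) x = 0) ∧ A ≠ 0 ∧
      ∀ t ∈ S, ∀ x, fderiv ℝ (u t) x (A (x - x₀)) - A (u t x) = 0

end Summit.NavierStokesRegularity.NavierStokesRegularity.Theorems.UnthreadedRigidity.MixedPair
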